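import Literature.Topology.FourManifolds.LatticeFormsPolarisationTypesSplitNonsplit
import HarnessLib

/-!
# Polarisation types of a general divisor `f` in `L_{2t} = B₀ ⊕ ⟨−2t⟩`: `h_d = f v + c l_t`, the `Õ`-orbits are the
# admissible `c mod f`, and `(h_d)^⊥ ≅ 2U ⊕ 2E₈(−1) ⊕ B` with `B = (−2b, c·2t/f; c·2t/f, −2t)`
# (Gritsenko–Hulek–Sankaran, *Compositio Math.* 146 (2010), §4 Prop. 4.6 — the core of the proof and part (iv))

Trunk T-4MAN vocabulary; sequel of `LatticeFormsPolarisationTypesSplitNonsplit.lean` (row g41-#4: the cases `f = 1, 2`,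
Examples 4.8/4.10/4.11, and the model plumbing `splitModel_vector_one/two`,
`restrict_orthogonal_hyperbolicForm_prod_neg_twoMul_smul_mul_equivalent'`), of `LatticeFormsNegTwoDVectorOrbitCount.lean`
(row g41-#2: `exists_fst_eq_smul_of_forall_dvd` — "`u` is divisible by `f`" — and the Eichler description of the
`Õ(B₀ ⊕ ⟨−2t⟩)`-orbit of a vector with `(h, L) = δℤ` by its `l_t`-coordinate modulo `δ`,
`exists_stable_isometryEquiv_apply_eq_iff_dvd_snd_sub_snd`) and of `LatticeFormsNegTwoVectorOrbits.lean` (g41-#1: the abstract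
lattice `B₀ ⊕ ⟨−2t⟩`, `prod_neg_twoMul_smul_mul_apply`, `TwoHyperbolicPairs`, transport lemmas). Written for lane
`lit-hodgefound` (Track 2 foundations; prover seat `lit-hodgefound-p18`, gen 43, row g43-#2). THEOREMS ONLY — no definition,
no named fact, no instance, no notation.

## Source, verbatim (V. Gritsenko, K. Hulek, G. K. Sankaran, Compositio Math. 146 (2010) 404–434, arXiv numbering §4,
held text `paper:arxiv-0802.2078` pp. 10–11)

"We consider the special lattice `L_{2t} = 3U ⊕ 2E₈(−1) ⊕ ⟨−2t⟩` […] We denote a generator of the `1`-dimensional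
sublattice `⟨−2t⟩` by `l_t`, so `l_t² = −2t`, and we denote by `h_d` a primitive vector of length `2d`. Note that `div(h_d)`
is a common divisor of `2d` and `2t = −det(L_{2t})`. […] **Proposition 4.6.** Let `h_d ∈ L_{2t}` be primitive of length
`2d > 0` and `div(h_d) = f`. […] (iv) For `c` a suitable integer, determined mod `f` and satisfying `(c, f) = 1`, and
`b = (d + c²t)/f²`, we have `(h_d)^⊥_{L_{2t}} ≅ 2U ⊕ 2E₈(−1) ⊕ B` with `B = (−2b  c·2t/f ∕ c·2t/f  −2t)`. The form `B` is a
negative definite binary quadratic form of determinant `4dt/f²`. […] *Proof.* A primitive vector `h_d` with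
`(h_d, L_{2t}) = fℤ` can be written `h_d = fv + cl_t` where `v ∈ 3U ⊕ 2E₈(−1)`. The coefficient `c` is coprime to `f`
because `h_d` is primitive. According to Eichler's criterion (Lemma 4.5) the `Õ(L_{2t})`-orbit of `h_d` is uniquely
determined by `h_d^* ≡ (c/f) l_t mod L_{2t}`. Therefore it is determined by `c mod f` because the discriminant group of
`L_{2t}` is cyclic. We put `v² = 2b`. Then `2d = 2bf² − 2c²t` […] (iv) Fix a representative of the `Õ(L_{2t})`-orbit of
`h_d` of the form `h_d = fe₁ + fbe₂ + cl_t ∈ U ⊕ ⟨−2t⟩` where `e₁` and `e₂` form a usual basis of the hyperbolic plane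
`U` […] The orthogonal complement of `h_d` in `U ⊕ ⟨−2t⟩` is a lattice `L_B` of rank `2`,
`L_B = ⟨e₁ − be₂, c(2t/f)e₂ + l_t⟩`, with the quadratic form `B` as in (iv). Both vectors are orthogonal to `h_d`: they
form a basis because using them one can reduce to zero the coordinates at `e₁` and at `l_t`."

## Reading notes

* ABSTRACTION as in g41: everything is proved for `L = B₀ ⊕ ⟨−2t⟩` on `M × ℤ`, `B₀` symmetric even unimodular with two
  orthogonal hyperbolic pairs `(x, y), (x₁, y₁)` (`L_{2t}`: `B₀ = L_{K3}`), then specialised to the models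
  `(E₈(−1)^{⊕m} ⊕ U^{⊕(n+2)}) ⊕ ℤ(−2t)` (`L_{2t}`: `m = 2`, `n = 1`). "`div(h) = f`" is "`f ∣ (h, z)` for all `z` and
  `(h, h') = f` for some `h'`"; "primitive" is "`h ≠ 0` and `ℤh` saturated"; the `l_t`-coordinate `c` of `h = (u, c)` is
  `h.2`, and "`h_d = fv + cl_t`" is `h.1 = f • v`.
* The number of orbits is obtained (§3) as a BIJECTION of the orbit set with the admissible residues
  `{c mod f : (c, f) = 1, f² ∣ d + c²t}` ("the number of solutions `c` modulo `f`", which Prop. 4.6 (i)–(iii) then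
  evaluates in closed form; the evaluation is NOT in this file). The congruence is read on the canonical lift `c.val`;
  it is independent of the lift because `f ∣ 2t` (§3, `sq_dvd_add_mul_sq_iff_of_dvd_sub`). Positivity `2d > 0` is not
  used and dropped.
* (iv) is proved for EVERY primitive `h` with `(h, L) = fℤ` (not only the representative), with `c = h.2`, `b` and
  `a = 2tc/f` supplied through the identities `f²b = d + c²t`, `fa = 2tc`; "negative definite" is not restated (it is
  `det B > 0`, `−2t < 0`); the determinant identity is `det B · f² = 4dt`.

## Contents (all proved)

* §1 arithmetic of `h = fv + cl_t`: `apply_self_eq_of_fst_eq_smul` (`h² = f²v² − 2tc²`), `dvd_two_mul_mul_snd_of_forall_dvd`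
  (`f ∣ 2tc`), **`gcd_snd_eq_one_of_primitive_of_forall_dvd`** ("`c` is coprime to `f` because `h_d` is primitive"),
  `sq_dvd_add_mul_snd_sq_of_forall_dvd` (`f² ∣ d + c²t`), `mem_span_singleton_of_smul_mem_of_dual_eq_one` and
  **`generalDivisor_repr`** (the representative `f(e₁ + be₂) + cl_t`: square `2(f²b − tc²)`, `(·, f₁) = f`, `f ∣ (·, L)`,
  primitive when `(c, f) = 1`).
* §2 orbits: **`exists_stable_isometryEquiv_apply_eq_repr_of_forall_dvd`** (every `h` with `h² = 2d`, `(h, L) = fℤ` is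
  `Õ`-equivalent to `f(e₁ + be₂) + h.2 l_t`), **`exists_primitive_apply_self_eq_snd_eq_iff`** (a primitive `h` with
  `h² = 2d`, `(h, L) = fℤ` and `l_t`-coordinate `c` exists iff `(c, f) = 1 ∧ f ∣ 2tc ∧ f² ∣ d + c²t`).
* §3 **`natCard_quot_stable_isometryEquiv_two_mul_of_divisor`**: for `f ∣ 2t`, the `Õ(L)`-orbits of primitive `h` with
  `h² = 2d`, `(h, L) = fℤ` are in bijection with `{c : ℤ/f // c unit, f² ∣ d + c²t}`.
* §4 (iv): `mem_orthogonal_span_generalDivisor_iff`, **`restrict_orthogonal_hyperbolicForm_prod_neg_twoMul_smul_mul_equivalent_of_mul_eq`**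
  (`(fe₁ + fbe₂ + cl_t)^⊥_{U ⊕ ⟨−2t⟩} ≅ B`), `det_generalDivisorGram_mul_sq` (`det B · f² = 4dt`), and for the models
  **`restrict_orthogonal_model_equivalent_of_divisor`** (`h^⊥ ≅ (E₈(−1)^{⊕m} ⊕ U^{⊕(n+1)}) ⊕ B` for every primitive `h`
  with `(h, L) = fℤ`) with `natCard_quot_stable_isometryEquiv_model_two_mul_of_divisor` (the count for the models).

## References

* [GritsenkoHulekSankaran2010Symplectic] V. Gritsenko, K. Hulek, G. K. Sankaran, Moduli spaces of irreducible symplectic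
  manifolds, Compositio Math. 146 (2010) 404–434 (arXiv:0802.2078): §4 Prop. 4.6 and its proof, Lemma 4.5, Examples 4.8–4.11.
* [GritsenkoHulekSankaran2009] V. Gritsenko, K. Hulek, G. K. Sankaran, Abelianisation of orthogonal groups and the
  fundamental group of modular varieties, J. Algebra 322 (2009): Prop. 3.3 (i) (Eichler criterion).
* [Serre1973] J.-P. Serre, A Course in Arithmetic, GTM 7, Ch. V §1.2, §3.2 Lemma 3.
-/

noncomputable section

open Module Function
open LinearMap (BilinForm)
open LinearMap.BilinForm

namespace Literature.Topology.FourManifolds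

universe u

/-! ### §1 `h_d = f v + c l_t`: the arithmetic of a vector with `f ∣ (h_d, L)` -/

section Arithmetic

variable {M : Type u} [AddCommGroup M] {B₀ : BilinForm ℤ M} (t : ℕ)

/-- **"We put `v² = 2b`. Then `2d = 2bf² − 2c²t`"**: if `h = (fv, c) ∈ B₀ ⊕ ⟨−2t⟩` then `h² = f²·v² − 2tc²`.
[cite: GritsenkoHulekSankaran2010Symplectic, §4 proof of Prop. 4.6] -/
theorem apply_self_eq_of_fst_eq_smul {r : M × ℤ} {f : ℤ} {v : M} (hv : r.1 = f • v) :
    B₀.prod ((-(2 * t : ℤ)) • LinearMap.mul ℤ ℤ) r r = f ^ 2 * B₀ v v - 2 * t * r.2 ^ 2 := by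
  rw [prod_neg_twoMul_smul_mul_apply, hv, map_zsmul, map_zsmul, LinearMap.smul_apply, smul_eq_mul, smul_eq_mul]
  ring

/-- **`f ∣ (h_d, l_t) = −2tc`**: if `f` divides every product `(h, z)` then `f ∣ 2t·c`, `c` the `l_t`-coordinate of `h`.
[cite: GritsenkoHulekSankaran2010Symplectic, §4 proof of Prop. 4.6 (iv) ("`c(2t/f)e₂ + l_t`", an integral vector)] -/
theorem dvd_two_mul_mul_snd_of_forall_dvd {r : M × ℤ} {f : ℤ} (hf : ∀ z, f ∣ B₀.prod ((-(2 * t : ℤ)) • LinearMap.mul ℤ ℤ) r z) :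
    f ∣ 2 * t * r.2 := by
  have h1 := hf (0, 1)
  rw [prod_neg_twoMul_smul_mul_apply, map_zero, mul_one, zero_sub, dvd_neg] at h1
  exact h1

/-- **"The coefficient `c` is coprime to `f` because `h_d` is primitive"**: for a primitive `h ∈ B₀ ⊕ ⟨−2t⟩` (`B₀`
unimodular) with `f ∣ (h, z)` for all `z` — so that `h = fv + cl_t` — one has `gcd(f, c) = 1`.
[cite: GritsenkoHulekSankaran2010Symplectic, §4 proof of Prop. 4.6] -/
theorem gcd_snd_eq_one_of_primitive_of_forall_dvd [Module.IsTorsionFree ℤ M] (hu : B₀.IsUnimodular) {r : M × ℤ}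
    {f : ℤ} (hr0 : r ≠ 0) (hsat : ∀ (k : ℤ) (w : M × ℤ), k ≠ 0 → k • w ∈ ℤ ∙ r → w ∈ ℤ ∙ r)
    (hf : ∀ z, f ∣ B₀.prod ((-(2 * t : ℤ)) • LinearMap.mul ℤ ℤ) r z) : Int.gcd f r.2 = 1 := by
  obtain ⟨v, hv⟩ := exists_fst_eq_smul_of_forall_dvd t hu hf
  set g := Int.gcd f r.2 with hgdef
  obtain ⟨f', hf'⟩ := Int.gcd_dvd_left f r.2
  obtain ⟨c', hc'⟩ := Int.gcd_dvd_right f r.2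
  have hg0 : (g : ℤ) ≠ 0 := by
    intro h0
    have hf0 : f = 0 := by rw [hf', ← hgdef, h0, zero_mul]
    have hc0 : r.2 = 0 := by rw [hc', ← hgdef, h0, zero_mul]
    exact hr0 (Prod.ext (by rw [hv, hf0, zero_smul]; rfl) hc0)
  have h1 : (g : ℤ) • (f' • v, c') = r :=
    Prod.ext (by change (g : ℤ) • f' • v = r.1; rw [smul_smul, ← hf', hv]) (by change (g : ℤ) * c' = r.2; rw [← hc'])
  have hmem : (f' • v, c') ∈ ℤ ∙ r := hsat g (f' • v, c') hg0 (by rw [h1]; exact Submodule.mem_span_singleton_self r)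
  obtain ⟨a, ha⟩ := Submodule.mem_span_singleton.1 hmem
  have h3 : ((g : ℤ) * a - 1) • r = 0 := by rw [sub_smul, mul_smul, ha, h1, one_smul, sub_self]
  rcases smul_eq_zero.1 h3 with h4 | h4
  · have h5 : (g : ℤ) * a = 1 := by linarith
    exact_mod_cast Int.eq_one_of_mul_eq_one_right (by positivity) h5
  · exact absurd h4 hr0

/-- **"`2d = 2bf² − 2c²t`", as a divisibility: `f² ∣ d + c²t`** for `h ∈ B₀ ⊕ ⟨−2t⟩` (`B₀` even unimodular) with `h² = 2d`
and `f ∣ (h, z)` for all `z` (`h = fv + cl_t`, `v² = 2b`, `f²b = d + c²t`). [cite: GritsenkoHulekSankaran2010Symplectic, §4 proof of Prop. 4.6 (display (c-eq): "`2f₁b = g₁(d₁ + c²t₁)`")] -/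
theorem sq_dvd_add_mul_snd_sq_of_forall_dvd (hu : B₀.IsUnimodular) (he : B₀.IsEven) {r : M × ℤ} {f d : ℤ}
    (hr : B₀.prod ((-(2 * t : ℤ)) • LinearMap.mul ℤ ℤ) r r = 2 * d)
    (hf : ∀ z, f ∣ B₀.prod ((-(2 * t : ℤ)) • LinearMap.mul ℤ ℤ) r z) : f ^ 2 ∣ d + t * r.2 ^ 2 := by
  obtain ⟨v, hv⟩ := exists_fst_eq_smul_of_forall_dvd t hu hf
  obtain ⟨b, hb⟩ := he v
  rw [apply_self_eq_of_fst_eq_smul t hv, hb] at hr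
  exact ⟨b, by linarith⟩

/-- **A vector on which some linear functional takes the value `1` spans a saturated line** (torsion-free module):
if `φ(u) = 1` and `k • w ∈ ℤu`, `k ≠ 0`, then `w = φ(w) u ∈ ℤu`. [cite: Serre1973, Ch. V §3.2 Lemma 3] -/
theorem mem_span_singleton_of_smul_mem_of_dual_eq_one {W : Type*} [AddCommGroup W] [Module.IsTorsionFree ℤ W]
    {u : W} (φ : W →ₗ[ℤ] ℤ) (hφ : φ u = 1) {k : ℤ} {w : W} (hk : k ≠ 0) (hw : k • w ∈ ℤ ∙ u) : w ∈ ℤ ∙ u := by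
  obtain ⟨a, ha⟩ := Submodule.mem_span_singleton.1 hw
  have hak : a = k * φ w := by
    have h1 := congrArg φ ha
    rw [map_zsmul, map_zsmul, hφ, smul_eq_mul, mul_one, smul_eq_mul] at h1
    exact h1
  have h2 : k • (w - φ w • u) = 0 := by rw [smul_sub, ← mul_smul, ← hak, ha, sub_self]
  have h3 : w - φ w • u = 0 := (smul_eq_zero_iff_right hk).1 h2
  exact Submodule.mem_span_singleton.2 ⟨φ w, (sub_eq_zero.1 h3).symm⟩

/-- **The representative `h_d = fe₁ + fbe₂ + cl_t`** ("Fix a representative of the `Õ(L_{2t})`-orbit of `h_d` of the form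
`h_d = fe₁ + fbe₂ + cl_t ∈ U ⊕ ⟨−2t⟩`"), in `B₀ ⊕ ⟨−2t⟩` with a hyperbolic pair `(x, y)` of `B₀` for `(e₁, e₂)`: the vector
`(f(x + by), c)` has square `2(f²b − tc²)`, product `f` with `(y, 0)`, all products divisible by `f` as soon as `f ∣ 2tc`,
`l_t`-coordinate `c`, and it is primitive as soon as `gcd(f, c) = 1`. [cite: GritsenkoHulekSankaran2010Symplectic, §4 proof of Prop. 4.6 (iv) (display (hd))] -/
theorem generalDivisor_repr [Module.IsTorsionFree ℤ M] {x y x₁ y₁ : M} (h : TwoHyperbolicPairs B₀ x y x₁ y₁) (f b c : ℤ) :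
    B₀.prod ((-(2 * t : ℤ)) • LinearMap.mul ℤ ℤ) (f • (x + b • y), c) (f • (x + b • y), c) = 2 * (f ^ 2 * b - t * c ^ 2) ∧
      B₀.prod ((-(2 * t : ℤ)) • LinearMap.mul ℤ ℤ) (f • (x + b • y), c) (y, 0) = f ∧
      (f ∣ 2 * t * c → ∀ z, f ∣ B₀.prod ((-(2 * t : ℤ)) • LinearMap.mul ℤ ℤ) (f • (x + b • y), c) z) ∧
      (Int.gcd f c = 1 → (f • (x + b • y), c) ≠ (0 : M × ℤ) ∧
        ∀ (k : ℤ) (w : M × ℤ), k ≠ 0 → k • w ∈ ℤ ∙ (f • (x + b • y), c) → w ∈ ℤ ∙ (f • (x + b • y), c)) := by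
  have hvy : B₀ (x + b • y) y = 1 := by
    simp only [map_add, map_zsmul, LinearMap.add_apply, LinearMap.smul_apply, smul_eq_mul, h.yy, h.xy]
    ring
  refine ⟨?_, ?_, fun hf z ↦ ?_, fun hg ↦ ?_⟩
  · rw [prod_neg_twoMul_smul_mul_apply]
    dsimp only
    simp only [map_add, map_zsmul, LinearMap.add_apply, LinearMap.smul_apply, smul_eq_mul, h.xx, h.yy, h.xy,
      h.isSymm.eq y x]
    ring
  · rw [prod_neg_twoMul_smul_mul_apply]
    dsimp only
    rw [map_zsmul, LinearMap.smul_apply, smul_eq_mul, hvy]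
    ring
  · rw [prod_neg_twoMul_smul_mul_apply]
    dsimp only
    rw [map_zsmul, LinearMap.smul_apply, smul_eq_mul]
    exact dvd_sub (Dvd.intro _ rfl) (by rw [← mul_assoc]; exact Dvd.dvd.mul_right hf _)
  · -- the functional `φ(w) = α (w₁, y) + β w₂` with `αf + βc = 1` takes the value `1` on the representative
    obtain ⟨α, β, hαβ⟩ := Int.isCoprime_iff_gcd_eq_one.2 hg
    let φ : M × ℤ →ₗ[ℤ] ℤ :=
      α • LinearMap.comp (LinearMap.applyₗ y) (LinearMap.comp B₀ (LinearMap.fst ℤ M ℤ)) + β • LinearMap.snd ℤ M ℤ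
    have hφ : ∀ w : M × ℤ, φ w = α * B₀ w.1 y + β * w.2 := fun w ↦ rfl
    have hφr : φ (f • (x + b • y), c) = 1 := by
      rw [hφ]
      dsimp only
      rw [map_zsmul, LinearMap.smul_apply, smul_eq_mul, hvy, mul_one, ← hαβ]
    refine ⟨fun h0 ↦ ?_, fun k w hk hw ↦ mem_span_singleton_of_smul_mem_of_dual_eq_one φ hφr hk hw⟩
    rw [h0, map_zero] at hφr
    exact zero_ne_one hφr

end Arithmetic

/-! ### §2 The `Õ`-orbit: determined by `c mod f`; the representative; existence -/

section Orbit

variable {M : Type u} [AddCommGroup M] [Module.Finite ℤ M] [Module.Free ℤ M] {B₀ : BilinForm ℤ M} (t : ℕ)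

/-- **Every `h_d` with `h_d² = 2d`, `(h_d, L) = fℤ` is `Õ(L_{2t})`-equivalent to the representative `fe₁ + fbe₂ + cl_t`**,
`c = ` the `l_t`-coordinate of `h_d`, `f²b = d + c²t` ("the `Õ(L_{2t})`-orbit of `h_d` is uniquely determined by
`h_d^* ≡ (c/f)l_t mod L_{2t}`. Therefore it is determined by `c mod f`"; Eichler, `B₀` even unimodular with two orthogonal
hyperbolic pairs `(x, y), (x₁, y₁)`, `t ≥ 1`). [cite: GritsenkoHulekSankaran2010Symplectic, §4 proof of Prop. 4.6, first paragraph and (iv)] [cite: GritsenkoHulekSankaran2009, Prop. 3.3 (i)] -/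
theorem exists_stable_isometryEquiv_apply_eq_repr_of_forall_dvd (hu : B₀.IsUnimodular) (he : B₀.IsEven) (ht : 0 < t)
    {x y x₁ y₁ : M} (h : TwoHyperbolicPairs B₀ x y x₁ y₁) {r r' : M × ℤ} {f d b : ℤ} (hf0 : f ≠ 0)
    (hr : B₀.prod ((-(2 * t : ℤ)) • LinearMap.mul ℤ ℤ) r r = 2 * d)
    (hfr : ∀ z, f ∣ B₀.prod ((-(2 * t : ℤ)) • LinearMap.mul ℤ ℤ) r z)
    (hr' : B₀.prod ((-(2 * t : ℤ)) • LinearMap.mul ℤ ℤ) r r' = f) (hb : f ^ 2 * b = d + t * r.2 ^ 2) :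
    ∃ g : (B₀.prod ((-(2 * t : ℤ)) • LinearMap.mul ℤ ℤ)).IsometryEquiv (B₀.prod ((-(2 * t : ℤ)) • LinearMap.mul ℤ ℤ)),
      g.discriminantGroupCongr = LinearEquiv.refl ℤ _ ∧ g r = (f • (x + b • y), r.2) := by
  haveI : Module.IsTorsionFree ℤ M := inferInstance
  obtain ⟨h1, h2, h3, -⟩ := generalDivisor_repr t h f b r.2
  refine (exists_stable_isometryEquiv_apply_eq_iff_dvd_snd_sub_snd t hu he ht h hf0 ?_ hfr
    (h3 (dvd_two_mul_mul_snd_of_forall_dvd t hfr)) hr' h2).2 (by simp)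
  rw [hr, h1, hb]
  ring

/-- **Existence of `h_d` with prescribed `c`**: a primitive `h ∈ B₀ ⊕ ⟨−2t⟩` with `h² = 2d`, `(h, L) = fℤ` and
`l_t`-coordinate `c` exists iff `(c, f) = 1`, `f ∣ 2tc` and `f² ∣ d + c²t` — then `h = f(e₁ + be₂) + cl_t` with
`f²b = d + c²t` ("If a `c` coprime to `f` and satisfying Equation (c-eq) exists …"). (`B₀` even unimodular with two
orthogonal hyperbolic pairs.) [cite: GritsenkoHulekSankaran2010Symplectic, §4 proof of Prop. 4.6 (display (c-eq) and the sentence after it)] -/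
theorem exists_primitive_apply_self_eq_snd_eq_iff (hu : B₀.IsUnimodular) (he : B₀.IsEven) {x y x₁ y₁ : M}
    (h : TwoHyperbolicPairs B₀ x y x₁ y₁) (f d c : ℤ) :
    (∃ r r' : M × ℤ, r.2 = c ∧ B₀.prod ((-(2 * t : ℤ)) • LinearMap.mul ℤ ℤ) r r = 2 * d ∧ r ≠ 0 ∧
        (∀ (k : ℤ) (w : M × ℤ), k ≠ 0 → k • w ∈ ℤ ∙ r → w ∈ ℤ ∙ r) ∧
        (∀ z, f ∣ B₀.prod ((-(2 * t : ℤ)) • LinearMap.mul ℤ ℤ) r z) ∧ B₀.prod ((-(2 * t : ℤ)) • LinearMap.mul ℤ ℤ) r r' = f) ↔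
      Int.gcd f c = 1 ∧ f ∣ 2 * t * c ∧ f ^ 2 ∣ d + t * c ^ 2 := by
  haveI : Module.IsTorsionFree ℤ M := inferInstance
  constructor
  · rintro ⟨r, r', hrc, hr, hr0, hsat, hfr, -⟩
    subst hrc
    exact ⟨gcd_snd_eq_one_of_primitive_of_forall_dvd t hu hr0 hsat hfr, dvd_two_mul_mul_snd_of_forall_dvd t hfr,
      sq_dvd_add_mul_snd_sq_of_forall_dvd t hu he hr hfr⟩
  · rintro ⟨hg, hf, ⟨b, hb⟩⟩
    obtain ⟨h1, h2, h3, h4⟩ := generalDivisor_repr t h f b c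
    obtain ⟨h5, h6⟩ := h4 hg
    exact ⟨(f • (x + b • y), c), (y, 0), rfl, by rw [h1, ← hb]; ring, h5, h6, h3 hf, h2⟩

end Orbit

/-! ### §3 The number of `Õ`-orbits = the number of admissible `c mod f` -/

section Count

variable {M : Type u} [AddCommGroup M] [Module.Finite ℤ M] [Module.Free ℤ M] {B₀ : BilinForm ℤ M} (t : ℕ)

/-- The congruence `f² ∣ d + c²t` depends only on `c mod f` when `f ∣ 2t` (`(c + kf)²t − c²t = 2ckft + k²f²t`).
[cite: GritsenkoHulekSankaran2010Symplectic, §4 proof of Prop. 4.6 ("the number of solutions `c` modulo `f`")] -/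
theorem sq_dvd_add_mul_sq_iff_of_dvd_sub {f : ℤ} (hf : f ∣ 2 * t) {c c' d : ℤ} (hcc : f ∣ c' - c) :
    f ^ 2 ∣ d + t * c ^ 2 ↔ f ^ 2 ∣ d + t * c' ^ 2 := by
  obtain ⟨k, hk⟩ := hcc
  obtain ⟨s, hs⟩ := hf
  have hc' : c' = c + f * k := by linarith
  have key : d + t * c' ^ 2 = d + t * c ^ 2 + f ^ 2 * (c * k * s + t * k ^ 2) := by
    rw [hc']
    linear_combination (c * k * f) * hs
  rw [key]
  refine ⟨fun h1 ↦ dvd_add h1 (Dvd.intro _ rfl), fun h1 ↦ ?_⟩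
  have h2 := dvd_sub h1 (dvd_mul_right (f ^ 2) (c * k * s + t * k ^ 2))
  rwa [add_sub_cancel_right] at h2

/-- `f² ∣ d + c²t` read on the canonical lift of `c mod f` (for `f ∣ 2t`).
[cite: GritsenkoHulekSankaran2010Symplectic, §4 proof of Prop. 4.6] -/
theorem sq_dvd_add_mul_val_sq_iff {f : ℕ} (hf0 : 0 < f) (hf : (f : ℤ) ∣ 2 * t) (c d : ℤ) :
    (f : ℤ) ^ 2 ∣ d + t * (((c : ZMod f)).val : ℤ) ^ 2 ↔ (f : ℤ) ^ 2 ∣ d + t * c ^ 2 := by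
  haveI : NeZero f := ⟨by omega⟩
  refine sq_dvd_add_mul_sq_iff_of_dvd_sub t hf ?_
  rw [← ZMod.intCast_eq_intCast_iff_dvd_sub, Int.cast_natCast, ZMod.natCast_zmod_val]

/-- **Prop. 4.6, the count: the `Õ(B₀ ⊕ ⟨−2t⟩)`-orbits of primitive vectors `h` of square `2d` with `(h, L) = fℤ` are in
bijection, via the `l_t`-coordinate `c mod f`, with `{c mod f : (c, f) = 1, f² ∣ d + c²t}`** ("the `Õ(L_{2t})`-orbit of
`h_d` is […] determined by `c mod f`"; "The number of `Õ(L_{2t})`-orbits of such `h_d`" = the number of admissible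
solutions `c mod f`, evaluated in (i)–(iii)). Hypotheses: `B₀` even unimodular with two orthogonal hyperbolic pairs,
`t ≥ 1`, `f ≥ 1`, `f ∣ 2t` ("`div(h_d)` is a common divisor of `2d` and `2t`").
[cite: GritsenkoHulekSankaran2010Symplectic, §4 Prop. 4.6 and proof, first paragraph] [cite: GritsenkoHulekSankaran2009, Prop. 3.3 (i)] -/
theorem natCard_quot_stable_isometryEquiv_two_mul_of_divisor (hu : B₀.IsUnimodular) (he : B₀.IsEven) (ht : 0 < t)
    {x y x₁ y₁ : M} (h : TwoHyperbolicPairs B₀ x y x₁ y₁) (d : ℤ) {f : ℕ} (hf0 : 0 < f) (hf : (f : ℤ) ∣ 2 * t) :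
    Nat.card (Quot fun r s : {r : M × ℤ // B₀.prod ((-(2 * t : ℤ)) • LinearMap.mul ℤ ℤ) r r = 2 * d ∧ r ≠ 0 ∧
        (∀ (k : ℤ) (w : M × ℤ), k ≠ 0 → k • w ∈ ℤ ∙ r → w ∈ ℤ ∙ r) ∧
        (∀ z, (f : ℤ) ∣ B₀.prod ((-(2 * t : ℤ)) • LinearMap.mul ℤ ℤ) r z) ∧
        ∃ r', B₀.prod ((-(2 * t : ℤ)) • LinearMap.mul ℤ ℤ) r r' = f} ↦
      ∃ g : (B₀.prod ((-(2 * t : ℤ)) • LinearMap.mul ℤ ℤ)).IsometryEquiv (B₀.prod ((-(2 * t : ℤ)) • LinearMap.mul ℤ ℤ)),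
        g.discriminantGroupCongr = LinearEquiv.refl ℤ _ ∧ g r.1 = s.1) =
      Nat.card {c : ZMod f // IsUnit c ∧ (f : ℤ) ^ 2 ∣ d + t * (c.val : ℤ) ^ 2} := by
  haveI : NeZero f := ⟨by omega⟩
  haveI : Module.IsTorsionFree ℤ M := inferInstance
  have hf0' : (f : ℤ) ≠ 0 := by exact_mod_cast hf0.ne'
  -- the complete invariant `c mod f`
  let F : {r : M × ℤ // B₀.prod ((-(2 * t : ℤ)) • LinearMap.mul ℤ ℤ) r r = 2 * d ∧ r ≠ 0 ∧
        (∀ (k : ℤ) (w : M × ℤ), k ≠ 0 → k • w ∈ ℤ ∙ r → w ∈ ℤ ∙ r) ∧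
        (∀ z, (f : ℤ) ∣ B₀.prod ((-(2 * t : ℤ)) • LinearMap.mul ℤ ℤ) r z) ∧
        ∃ r', B₀.prod ((-(2 * t : ℤ)) • LinearMap.mul ℤ ℤ) r r' = f} →
      {c : ZMod f // IsUnit c ∧ (f : ℤ) ^ 2 ∣ d + t * (c.val : ℤ) ^ 2} :=
    fun r ↦ ⟨(r.1.2 : ZMod f),
      (ZMod.coe_int_isUnit_iff_isCoprime _ _).2 (Int.isCoprime_iff_gcd_eq_one.2
        (gcd_snd_eq_one_of_primitive_of_forall_dvd t hu r.2.2.1 r.2.2.2.1 r.2.2.2.2.1)),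
      (sq_dvd_add_mul_val_sq_iff t hf0 hf _ d).2 (sq_dvd_add_mul_snd_sq_of_forall_dvd t hu he r.2.1 r.2.2.2.2.1)⟩
  have key : ∀ r s : {r : M × ℤ // B₀.prod ((-(2 * t : ℤ)) • LinearMap.mul ℤ ℤ) r r = 2 * d ∧ r ≠ 0 ∧
        (∀ (k : ℤ) (w : M × ℤ), k ≠ 0 → k • w ∈ ℤ ∙ r → w ∈ ℤ ∙ r) ∧
        (∀ z, (f : ℤ) ∣ B₀.prod ((-(2 * t : ℤ)) • LinearMap.mul ℤ ℤ) r z) ∧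
        ∃ r', B₀.prod ((-(2 * t : ℤ)) • LinearMap.mul ℤ ℤ) r r' = f},
      (∃ g : (B₀.prod ((-(2 * t : ℤ)) • LinearMap.mul ℤ ℤ)).IsometryEquiv (B₀.prod ((-(2 * t : ℤ)) • LinearMap.mul ℤ ℤ)),
        g.discriminantGroupCongr = LinearEquiv.refl ℤ _ ∧ g r.1 = s.1) ↔ F r = F s := by
    rintro ⟨r, hr, hr0, hrsat, hfr, r', hr'⟩ ⟨s, hs, hs0, hssat, hfs, s', hs'⟩
    rw [exists_stable_isometryEquiv_apply_eq_iff_dvd_snd_sub_snd t hu he ht h hf0' (hr.trans hs.symm) hfr hfs hr' hs',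
      Subtype.ext_iff]
    change _ ↔ (r.2 : ZMod f) = (s.2 : ZMod f)
    rw [ZMod.intCast_eq_intCast_iff_dvd_sub, dvd_sub_comm]
  refine Nat.card_congr (Equiv.ofBijective (Quot.lift F fun r s hrs ↦ (key r s).1 hrs) ⟨?_, ?_⟩)
  · rintro ⟨r⟩ ⟨s⟩ hrs
    exact Quot.sound ((key r s).2 hrs)
  · rintro ⟨cc, hcu, hcc⟩
    -- `c = cc.val` is admissible: coprime to `f`, `f ∣ 2tc`, `f² ∣ d + c²t`
    have hg : Int.gcd f (cc.val : ℤ) = 1 := by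
      rw [Int.gcd_natCast_natCast]
      have h1 : IsUnit ((cc.val : ℕ) : ZMod f) := by rw [ZMod.natCast_zmod_val]; exact hcu
      exact Nat.Coprime.symm ((ZMod.isUnit_iff_coprime _ _).1 h1)
    obtain ⟨r, r', hrc, hr, hr0, hsat, hfr, hr'⟩ := (exists_primitive_apply_self_eq_snd_eq_iff t hu he h (f : ℤ) d
      (cc.val : ℤ)).2 ⟨hg, Dvd.dvd.mul_right hf _, hcc⟩
    refine ⟨Quot.mk _ ⟨r, hr, hr0, hsat, hfr, r', hr'⟩, Subtype.ext ?_⟩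
    change (r.2 : ZMod f) = cc
    rw [hrc, Int.cast_natCast, ZMod.natCast_zmod_val]

end Count

/-! ### §4 Prop. 4.6 (iv): `(h_d)^⊥ ≅ 2U ⊕ 2E₈(−1) ⊕ B`, `B = (−2b, 2tc/f; 2tc/f, −2t)` -/

section Complement

variable (t : ℕ)

/-- Evaluation of GHS's form `B = (−2b a ∕ a −2t)` (`a = c·2t/f`). [cite: GritsenkoHulekSankaran2010Symplectic, §4 Prop. 4.6 (iv)] -/
theorem toBilin'_generalDivisorGram_apply (b a : ℤ) (p q : Fin 2 → ℤ) :
    Matrix.toBilin' !![-(2 * b), a; a, -(2 * t : ℤ)] p q = p 0 * (-(2 * b) * q 0 + a * q 1) + p 1 * (a * q 0 - 2 * t * q 1) := by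
  rw [Matrix.toBilin'_apply]
  simp only [Fin.sum_univ_two, Matrix.of_apply, Matrix.cons_val', Matrix.cons_val_zero, Matrix.cons_val_one,
    Matrix.empty_val', Matrix.cons_val_fin_one]
  ring

/-- **`det B = 4dt/f²`**: `det (−2b a ∕ a −2t) · f² = 4dt` when `f²b = d + c²t` and `fa = 2tc`.
[cite: GritsenkoHulekSankaran2010Symplectic, §4 Prop. 4.6 (iv) ("The form `B` is a negative definite binary quadratic form of determinant `4dt/f²`")] -/
theorem det_generalDivisorGram_mul_sq {f b c a d : ℤ} (hb : f ^ 2 * b = d + t * c ^ 2) (ha : f * a = 2 * t * c) :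
    Matrix.det !![-(2 * b), a; a, -(2 * t : ℤ)] * f ^ 2 = 4 * d * t := by
  rw [Matrix.det_fin_two_of]
  linear_combination (4 * (t : ℤ)) * hb - (f * a + 2 * t * c) * ha

/-- In `U ⊕ ⟨−2t⟩`: `w = w₀e₁ + w₁e₂ + w₂l_t ⊥ fe₁ + fbe₂ + cl_t` iff `w₁ = aw₂ − bw₀`, where `fa = 2tc`, `f ≠ 0`
("using them one can reduce to zero the coordinates at `e₁` and at `l_t`").
[cite: GritsenkoHulekSankaran2010Symplectic, §4 proof of Prop. 4.6 (iv) (display (LB))] -/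
theorem mem_orthogonal_span_generalDivisor_iff {f b c a : ℤ} (hf : f ≠ 0) (ha : f * a = 2 * t * c) (w : (Fin 2 → ℤ) × ℤ) :
    w ∈ (hyperbolicForm.prod ((-(2 * t : ℤ)) • LinearMap.mul ℤ ℤ)).orthogonal (ℤ ∙ ((![f, f * b] : Fin 2 → ℤ), c)) ↔
      w.1 1 = a * w.2 - b * w.1 0 := by
  rw [(hyperbolicForm.prod ((-(2 * t : ℤ)) • LinearMap.mul ℤ ℤ)).mem_orthogonal_span_singleton_iff,
    hyperbolicForm_prod_neg_twoMul_smul_mul_apply]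
  simp only [Matrix.cons_val_zero, Matrix.cons_val_one]
  constructor
  · intro h1
    have h2 : f * (w.1 1 - (a * w.2 - b * w.1 0)) = 0 := by linear_combination h1 - w.2 * ha
    exact sub_eq_zero.1 ((mul_eq_zero.1 h2).resolve_left hf)
  · intro h1
    rw [h1]
    linear_combination w.2 * ha

/-- **Prop. 4.6 (iv) in `U ⊕ ⟨−2t⟩`: `(fe₁ + fbe₂ + cl_t)^⊥ = ⟨e₁ − be₂, ae₂ + l_t⟩`, `a = 2tc/f`, has Gram matrix
`B = (−2b a ∕ a −2t)`** (`f ≠ 0`, `fa = 2tc`). [cite: GritsenkoHulekSankaran2010Symplectic, §4 Prop. 4.6 (iv) and its proof (displays (hd), (LB))] -/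
theorem restrict_orthogonal_hyperbolicForm_prod_neg_twoMul_smul_mul_equivalent_of_mul_eq {f b c a : ℤ} (hf : f ≠ 0)
    (ha : f * a = 2 * t * c) :
    ((hyperbolicForm.prod ((-(2 * t : ℤ)) • LinearMap.mul ℤ ℤ)).restrict
        ((hyperbolicForm.prod ((-(2 * t : ℤ)) • LinearMap.mul ℤ ℤ)).orthogonal
          (ℤ ∙ ((![f, f * b] : Fin 2 → ℤ), c)))).Equivalent
      (Matrix.toBilin' !![-(2 * b), a; a, -(2 * t : ℤ)]) := by
  let g : (Fin 2 → ℤ) ≃ₗ[ℤ] (hyperbolicForm.prod ((-(2 * t : ℤ)) • LinearMap.mul ℤ ℤ)).orthogonal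
      (ℤ ∙ ((![f, f * b] : Fin 2 → ℤ), c)) :=
    { toFun := fun p ↦ ⟨(![p 0, a * p 1 - b * p 0], p 1), (mem_orthogonal_span_generalDivisor_iff t hf ha _).2 (by simp)⟩
      invFun := fun w ↦ ![w.1.1 0, w.1.2]
      map_add' := fun p q ↦ by
        ext i
        · fin_cases i <;> simp
          ring
        · simp
      map_smul' := fun k p ↦ by
        ext i
        · fin_cases i <;> simp
          ring
        · simp
      left_inv := fun p ↦ by
        ext i
        fin_cases i <;> simp
      right_inv := fun w ↦ by
        have hw := (mem_orthogonal_span_generalDivisor_iff t hf ha w.1).1 w.2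
        ext i
        · fin_cases i
          · simp
          · simp only [Fin.mk_one, Matrix.cons_val_one, Matrix.cons_val_zero]
            rw [hw]
        · simp }
  have hg : ∀ p, (g p : (Fin 2 → ℤ) × ℤ) = (![p 0, a * p 1 - b * p 0], p 1) := fun p ↦ rfl
  refine Equivalent.symm ⟨{ g with map_app' := fun p q ↦ ?_ }⟩
  change hyperbolicForm.prod ((-(2 * t : ℤ)) • LinearMap.mul ℤ ℤ) (g p : (Fin 2 → ℤ) × ℤ) (g q : (Fin 2 → ℤ) × ℤ) =
    Matrix.toBilin' !![-(2 * b), a; a, -(2 * t : ℤ)] p q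
  rw [hyperbolicForm_prod_neg_twoMul_smul_mul_apply, hg, hg, toBilin'_generalDivisorGram_apply]
  simp only [Matrix.cons_val_zero, Matrix.cons_val_one]
  ring

end Complement

/-! #### The models `(E₈(−1)^{⊕m} ⊕ U^{⊕(n+2)}) ⊕ ℤ(−2t)` (`L_{2t}`: `m = 2`, `n = 1`) -/

section Model

variable (m n t : ℕ)

/-- The representative `fe + fbf' + cl_t` in the last plane of `((E₈(−1)^{⊕m} ⊕ U^{⊕(n+1)}) ⊕ U) ⊕ ℤ(−2t)`: square
`2(f²b − tc²)`, product `f` with `f'`, and `f ∣` all products when `fa = 2tc`. [cite: GritsenkoHulekSankaran2010Symplectic, §4 proof of Prop. 4.6 (iv) (display (hd))] -/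
theorem splitModel_vector_generalDivisor (f b c : ℤ) :
    ((((LinearMap.BilinForm.pi fun _ : Fin m ↦ -e8Form).prod (hyperbolicSum (n + 1))).prod hyperbolicForm).prod
        ((-(2 * t : ℤ)) • LinearMap.mul ℤ ℤ))
          (((0 : (Fin m → Fin 8 → ℤ) × ((Fin (n + 1) → ℤ) × (Fin (n + 1) → ℤ))), ![f, f * b]), c)
          (((0 : (Fin m → Fin 8 → ℤ) × ((Fin (n + 1) → ℤ) × (Fin (n + 1) → ℤ))), ![f, f * b]), c) =
        2 * (f ^ 2 * b - t * c ^ 2) ∧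
      ((((LinearMap.BilinForm.pi fun _ : Fin m ↦ -e8Form).prod (hyperbolicSum (n + 1))).prod hyperbolicForm).prod
        ((-(2 * t : ℤ)) • LinearMap.mul ℤ ℤ))
          (((0 : (Fin m → Fin 8 → ℤ) × ((Fin (n + 1) → ℤ) × (Fin (n + 1) → ℤ))), ![f, f * b]), c)
          (((0 : (Fin m → Fin 8 → ℤ) × ((Fin (n + 1) → ℤ) × (Fin (n + 1) → ℤ))), ![0, 1]), 0) = f ∧
      (∀ a : ℤ, f * a = 2 * t * c → ∀ z, f ∣ ((((LinearMap.BilinForm.pi fun _ : Fin m ↦ -e8Form).prod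
        (hyperbolicSum (n + 1))).prod hyperbolicForm).prod ((-(2 * t : ℤ)) • LinearMap.mul ℤ ℤ))
          (((0 : (Fin m → Fin 8 → ℤ) × ((Fin (n + 1) → ℤ) × (Fin (n + 1) → ℤ))), ![f, f * b]), c) z) := by
  refine ⟨?_, ?_, fun a ha z ↦ ?_⟩
  · simp [LinearMap.BilinForm.prod_apply, hyperbolicForm_apply]
    ring
  · simp [LinearMap.BilinForm.prod_apply, hyperbolicForm_apply]
  · simp only [LinearMap.BilinForm.prod_apply, hyperbolicForm_apply, smul_mul_apply, map_zero, LinearMap.zero_apply,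
      zero_add, Matrix.cons_val_zero, Matrix.cons_val_one]
    exact ⟨z.1.2 1 + b * z.1.2 0 - a * z.2, by linear_combination z.2 * ha⟩

/-- **Prop. 4.6 (iv) for the models: `h^⊥ ≅ (E₈(−1)^{⊕m} ⊕ U^{⊕(n+1)}) ⊕ B`, `B = (−2b a ∕ a −2t)`, for EVERY primitive `h`
of `(E₈(−1)^{⊕m} ⊕ U^{⊕(n+2)}) ⊕ ℤ(−2t)` with `h² = 2d` and `(h, L) = fℤ`** (`t ≥ 1`, `f ≠ 0`), where `c = h.2` is the
`l_t`-coordinate, `f²b = d + c²t` and `fa = 2tc` (`a = c·2t/f`): `h` is `Õ`-equivalent to the representative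
`fe₁ + fbe₂ + cl_t` of the last hyperbolic plane, whose complement is `(everything else) ⊕ L_B`. For `m = 2`, `n = 1` this is
"`(h_d)^⊥_{L_{2t}} ≅ 2U ⊕ 2E₈(−1) ⊕ B`". [cite: GritsenkoHulekSankaran2010Symplectic, §4 Prop. 4.6 (iv) and its proof] -/
theorem restrict_orthogonal_model_equivalent_of_divisor (ht : 0 < t) {f d b a : ℤ} (hf : f ≠ 0)
    {r : ((Fin m → Fin 8 → ℤ) × ((Fin (n + 2) → ℤ) × (Fin (n + 2) → ℤ))) × ℤ}
    (hr : (((LinearMap.BilinForm.pi fun _ : Fin m ↦ -e8Form).prod (hyperbolicSum (n + 2))).prod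
      ((-(2 * t : ℤ)) • LinearMap.mul ℤ ℤ)) r r = 2 * d)
    (hfr : ∀ z, f ∣ (((LinearMap.BilinForm.pi fun _ : Fin m ↦ -e8Form).prod (hyperbolicSum (n + 2))).prod
      ((-(2 * t : ℤ)) • LinearMap.mul ℤ ℤ)) r z)
    (hr' : ∃ r', (((LinearMap.BilinForm.pi fun _ : Fin m ↦ -e8Form).prod (hyperbolicSum (n + 2))).prod
      ((-(2 * t : ℤ)) • LinearMap.mul ℤ ℤ)) r r' = f)
    (hb : f ^ 2 * b = d + t * r.2 ^ 2) (ha : f * a = 2 * t * r.2) :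
    (((((LinearMap.BilinForm.pi fun _ : Fin m ↦ -e8Form).prod (hyperbolicSum (n + 2))).prod
        ((-(2 * t : ℤ)) • LinearMap.mul ℤ ℤ)).restrict
      ((((LinearMap.BilinForm.pi fun _ : Fin m ↦ -e8Form).prod (hyperbolicSum (n + 2))).prod
        ((-(2 * t : ℤ)) • LinearMap.mul ℤ ℤ)).orthogonal (ℤ ∙ r)))).Equivalent
      (((LinearMap.BilinForm.pi fun _ : Fin m ↦ -e8Form).prod (hyperbolicSum (n + 1))).prod
        (Matrix.toBilin' !![-(2 * b), a; a, -(2 * t : ℤ)])) := by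
  obtain ⟨-, heB, huB⟩ := isSymm_isEven_isUnimodular_pi_neg_e8Form_prod_hyperbolicSum' m (n + 2)
  obtain ⟨e₁⟩ : ((LinearMap.BilinForm.pi fun _ : Fin m ↦ -e8Form).prod (hyperbolicSum (n + 2))).Equivalent
      (((LinearMap.BilinForm.pi fun _ : Fin m ↦ -e8Form).prod (hyperbolicSum (n + 1))).prod hyperbolicForm) :=
    prod_hyperbolicSum_succ_equivalent _ (n + 1)
  let φ := e₁.prodCongr (LinearMap.BilinForm.IsometryEquiv.refl ((-(2 * t : ℤ)) • LinearMap.mul ℤ ℤ))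
  obtain ⟨h1, h1', h1''⟩ := splitModel_vector_generalDivisor m n t f b r.2
  set r₂' : (((Fin m → Fin 8 → ℤ) × ((Fin (n + 1) → ℤ) × (Fin (n + 1) → ℤ))) × (Fin 2 → ℤ)) × ℤ :=
    (((0 : (Fin m → Fin 8 → ℤ) × ((Fin (n + 1) → ℤ) × (Fin (n + 1) → ℤ))), ![f, f * b]), r.2) with hr₂'
  set r₂ := φ.symm r₂' with hr₂
  have hφr₂ : φ r₂ = r₂' := φ.toLinearEquiv.apply_symm_apply _
  -- the `l_t`-coordinate of `r₂` is that of `r`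
  have hr₂snd : r₂.2 = r.2 := by
    have h2 := congrArg Prod.snd hφr₂
    rw [LinearMap.BilinForm.IsometryEquiv.prodCongr_apply] at h2
    exact h2
  have hr₂r₂ : (((LinearMap.BilinForm.pi fun _ : Fin m ↦ -e8Form).prod (hyperbolicSum (n + 2))).prod
      ((-(2 * t : ℤ)) • LinearMap.mul ℤ ℤ)) r₂ r₂ = 2 * d := by
    rw [hr₂, φ.symm.map_app, h1, hb]
    ring
  have hfr₂ := (forall_dvd_apply_iff_of_isometryEquiv φ.symm r₂' f).2 (h1'' a ha)
  obtain ⟨z, hz⟩ := (exists_apply_eq_iff_of_isometryEquiv φ.symm r₂' f).2 ⟨_, h1'⟩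
  obtain ⟨r', hr'⟩ := hr'
  obtain ⟨g, -, hg⟩ := (exists_stable_isometryEquiv_apply_eq_iff_dvd_snd_sub_snd t huB heB ht
    (twoHyperbolicPairs_pi_neg_e8Form_prod_hyperbolicSum_add_two m n) hf (hr.trans hr₂r₂.symm) hfr hfr₂ hr' hz).2
    (by rw [hr₂snd, sub_self]; exact dvd_zero f)
  have hA := restrict_orthogonal_equivalent_of_isometryEquiv g r
  rw [hg] at hA
  have hB := restrict_orthogonal_equivalent_of_isometryEquiv φ r₂
  rw [hφr₂] at hB
  let ψ := LinearMap.BilinForm.IsometryEquiv.prodAssoc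
    ((LinearMap.BilinForm.pi fun _ : Fin m ↦ -e8Form).prod (hyperbolicSum (n + 1))) hyperbolicForm
    ((-(2 * t : ℤ)) • LinearMap.mul ℤ ℤ)
  have hB' := restrict_orthogonal_equivalent_of_isometryEquiv ψ r₂'
  have hψ : ψ r₂' = ((0 : (Fin m → Fin 8 → ℤ) × ((Fin (n + 1) → ℤ) × (Fin (n + 1) → ℤ))),
      ((![f, f * b] : Fin 2 → ℤ), r.2)) := rfl
  rw [hψ] at hB'
  have hC := restrict_orthogonal_zero_prod_equivalent
    ((LinearMap.BilinForm.pi fun _ : Fin m ↦ -e8Form).prod (hyperbolicSum (n + 1)))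
    (hyperbolicForm.prod ((-(2 * t : ℤ)) • LinearMap.mul ℤ ℤ)) ((![f, f * b] : Fin 2 → ℤ), r.2)
  have hD := restrict_orthogonal_hyperbolicForm_prod_neg_twoMul_smul_mul_equivalent_of_mul_eq t (b := b) hf ha
  exact hA.trans (hB.trans (hB'.trans (hC.trans ((Equivalent.refl _).prod hD))))

/-- **Prop. 4.6, the count, for the models**: in `(E₈(−1)^{⊕m} ⊕ U^{⊕(n+2)}) ⊕ ℤ(−2t)` (`t ≥ 1`; `f ≥ 1`, `f ∣ 2t`) the
`Õ`-orbits of primitive `h` with `h² = 2d`, `(h, L) = fℤ` are in bijection with `{c mod f : (c, f) = 1, f² ∣ d + c²t}`.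
[cite: GritsenkoHulekSankaran2010Symplectic, §4 Prop. 4.6 and proof] -/
theorem natCard_quot_stable_isometryEquiv_model_two_mul_of_divisor (ht : 0 < t) (d : ℤ) {f : ℕ} (hf0 : 0 < f)
    (hf : (f : ℤ) ∣ 2 * t) :
    Nat.card (Quot fun r s : {r : ((Fin m → Fin 8 → ℤ) × ((Fin (n + 2) → ℤ) × (Fin (n + 2) → ℤ))) × ℤ //
        (((LinearMap.BilinForm.pi fun _ : Fin m ↦ -e8Form).prod (hyperbolicSum (n + 2))).prod
          ((-(2 * t : ℤ)) • LinearMap.mul ℤ ℤ)) r r = 2 * d ∧ r ≠ 0 ∧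
        (∀ (k : ℤ) (w : ((Fin m → Fin 8 → ℤ) × ((Fin (n + 2) → ℤ) × (Fin (n + 2) → ℤ))) × ℤ), k ≠ 0 →
          k • w ∈ ℤ ∙ r → w ∈ ℤ ∙ r) ∧
        (∀ z, (f : ℤ) ∣ (((LinearMap.BilinForm.pi fun _ : Fin m ↦ -e8Form).prod (hyperbolicSum (n + 2))).prod
          ((-(2 * t : ℤ)) • LinearMap.mul ℤ ℤ)) r z) ∧
        ∃ r', (((LinearMap.BilinForm.pi fun _ : Fin m ↦ -e8Form).prod (hyperbolicSum (n + 2))).prod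
          ((-(2 * t : ℤ)) • LinearMap.mul ℤ ℤ)) r r' = f} ↦
      ∃ g : ((((LinearMap.BilinForm.pi fun _ : Fin m ↦ -e8Form).prod (hyperbolicSum (n + 2))).prod
          ((-(2 * t : ℤ)) • LinearMap.mul ℤ ℤ))).IsometryEquiv
          ((((LinearMap.BilinForm.pi fun _ : Fin m ↦ -e8Form).prod (hyperbolicSum (n + 2))).prod
          ((-(2 * t : ℤ)) • LinearMap.mul ℤ ℤ))),
        g.discriminantGroupCongr = LinearEquiv.refl ℤ _ ∧ g r.1 = s.1) =
      Nat.card {c : ZMod f // IsUnit c ∧ (f : ℤ) ^ 2 ∣ d + t * (c.val : ℤ) ^ 2} := by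
  obtain ⟨-, heB, huB⟩ := isSymm_isEven_isUnimodular_pi_neg_e8Form_prod_hyperbolicSum' m (n + 2)
  exact natCard_quot_stable_isometryEquiv_two_mul_of_divisor t huB heB ht
    (twoHyperbolicPairs_pi_neg_e8Form_prod_hyperbolicSum_add_two m n) d hf0 hf

end Model

end Literature.Topology.FourManifolds
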